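import Mathlib

/-!
# K2Q first rung, part 1 (route `Q8SymplecticPowers`) — quaternionic transvections and dilations

Helper file for `Theorems.Q8CommutatorDegreeTwoCore` (BC5 / T3 rung of crux
`PowersHodgeOfQuaternionCommutators`, route `Q8SymplecticPowers`, hodge-nonav P3): pure linear algebra
over a field `K` of characteristic zero.  Data: a SYMMETRIC bilinear form `Q` on `V` and two
`Q`-isometries `a b` with `a (a x) = -x`, `b (b x) = -x`, `a (b x) = - b (a x)` (the typed Q₈ deck pair
restricted to the `(-1)`-eigenspace of `τ*²`).

## Contents

* §0 pairing identities for the quaternionic data (`b_skew`, `eigen_isotropic`, …);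
* §1 the quaternionic transvections `x ↦ x + (l * Q x (b v)) • v - (l * Q x v) • b v` along an
  `i`-eigenvector `v` of `a`: composition, isometry, commutation with `a` and `b`, packaging as a
  linear equivalence (`exists_qtransvection_equiv`);
* §2 the multiplier lemma `multiplier_of_identity` (a bilinear form invariant under all transvections of
  a hyperbolic pair is a multiple of the pairing on it);
* §1b hyperbolic dilations on a pair `v w ∈ M`, `Q v (b w) = 1` (`exists_qdilation_equiv`) and their
  conjugation action on transvections (`qdilation_qtransvection`).

Part 2 (`Theorems.Q8CommutatorDegreeTwoCore`) proves that these transvections are commutators in the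
quaternionic centraliser and the degree-2 invariant statement.  hodge-nonav planner P3 g35, 2026-08-29.
No new axioms, no sorries, `import Mathlib` only.
-/

namespace Summit.HodgeConjecture.HodgeConjecture.Theorems.Q8CommutatorDegreeTwoCoreTransvections

open LinearMap

variable {K V : Type*} [Field K] [AddCommGroup V] [Module K V] {Q : LinearMap.BilinForm K V}
/-! ### §0 Pairing identities for the quaternionic data -/

/-- `Q x (b y) = - Q y (b x)`: the form `ω x y = Q x (b y)` is skew (`Q` symmetric, `b` an
isometry with `b (b x) = -x`). -/
theorem b_skew (hQs : ∀ x y, Q x y = Q y x) {b : V →ₗ[K] V} (hbb : ∀ x, b (b x) = -x)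
    (hQb : ∀ x y, Q (b x) (b y) = Q x y) (x y : V) : Q x (b y) = -Q y (b x) := by
  have h1 : Q (b y) (b (b x)) = Q y (b x) := hQb y (b x)
  rw [hbb, map_neg, hQs (b y) x] at h1
  linear_combination -h1

/-- `Q (b x) y = - Q x (b y)`. -/
theorem b_left (hQs : ∀ x y, Q x y = Q y x) {b : V →ₗ[K] V} (hbb : ∀ x, b (b x) = -x)
    (hQb : ∀ x y, Q (b x) (b y) = Q x y) (x y : V) : Q (b x) y = -Q x (b y) := by
  rw [hQs (b x) y, b_skew hQs hbb hQb y x]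

/-- `Q x (b x) = 0`. -/
theorem b_self [CharZero K] (hQs : ∀ x y, Q x y = Q y x) {b : V →ₗ[K] V}
    (hbb : ∀ x, b (b x) = -x) (hQb : ∀ x y, Q (b x) (b y) = Q x y) (x : V) : Q x (b x) = 0 := by
  have h := b_skew hQs hbb hQb x x
  have h2 : (2 : K) * Q x (b x) = 0 := by linear_combination h
  simpa using h2

/-- `Q (a x) u = -(ε * Q x u)` for an `ε`-eigenvector `u` of the `Q`-isometry `a`, `ε * ε = -1`. -/
theorem apply_a_eigenvector {a : V →ₗ[K] V} (haQ : ∀ x y, Q (a x) (a y) = Q x y)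
    {u : V} {ε : K} (hε : ε * ε = -1) (hu : a u = ε • u) (x : V) :
    Q (a x) u = -(ε * Q x u) := by
  have h1 : Q (a x) (a u) = Q x u := haQ x u
  rw [hu, map_smul, smul_eq_mul] at h1
  calc Q (a x) u = -(ε * (ε * Q (a x) u)) := by rw [← mul_assoc, hε]; ring
    _ = -(ε * Q x u) := by rw [h1]

/-- Two eigenvectors of `a` for the same eigenvalue `ε`, `ε * ε = -1`, are `Q`-orthogonal
(the eigenspaces `M = ker (a - i)`, `M' = ker (a + i)` are totally isotropic). -/
theorem eigen_isotropic [CharZero K] {a : V →ₗ[K] V} (haQ : ∀ x y, Q (a x) (a y) = Q x y)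
    {u u' : V} {ε : K} (hε : ε * ε = -1) (hu : a u = ε • u) (hu' : a u' = ε • u') :
    Q u u' = 0 := by
  have h1 := apply_a_eigenvector haQ hε hu' u
  rw [hu, map_smul, LinearMap.smul_apply, smul_eq_mul] at h1
  have hε0 : ε ≠ 0 := by
    rintro rfl
    norm_num at hε
  have h2 : (2 * ε) * Q u u' = 0 := by linear_combination h1
  rcases mul_eq_zero.mp h2 with h | h
  · exact absurd h (mul_ne_zero two_ne_zero hε0)
  · exact h

/-- `b` maps the `ε`-eigenspace of `a` to the `(-ε)`-eigenspace (`a b = - b a`). -/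
theorem b_eigen {a b : V →ₗ[K] V} (hab : ∀ x, a (b x) = -b (a x)) {v : V} {ε : K}
    (hv : a v = ε • v) : a (b v) = (-ε) • b v := by
  rw [hab, hv, map_smul, neg_smul]

/-! ### §1 Quaternionic transvections `T x = x + (l * Q x (b v)) • v + (-(l * Q x v)) • b v` -/

section transvection

variable (hQs : ∀ x y, Q x y = Q y x) {a b : V →ₗ[K] V}
  (haQ : ∀ x y, Q (a x) (a y) = Q x y) (hbb : ∀ x, b (b x) = -x)
  (hQb : ∀ x y, Q (b x) (b y) = Q x y) {i : K} (hi : i * i = -1) {v : V} (hv : a v = i • v)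
include hQs haQ hbb hQb hi hv

/-- The pairing table on `v, b v`: all four self-pairings vanish. -/
theorem table_v [CharZero K] :
    Q v v = 0 ∧ Q v (b v) = 0 ∧ Q (b v) v = 0 ∧ Q (b v) (b v) = 0 := by
  refine ⟨eigen_isotropic haQ hi hv hv, b_self hQs hbb hQb v, ?_, ?_⟩
  · rw [hQs, b_self hQs hbb hQb v]
  · rw [hQb, eigen_isotropic haQ hi hv hv]

/-- Transvections along a fixed `v` compose additively in the parameter. -/
theorem qtransvection_comp [CharZero K] {l l' : K} {T T' : V → V}
    (hT : ∀ x, T x = x + (l * Q x (b v)) • v + (-(l * Q x v)) • b v)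
    (hT' : ∀ x, T' x = x + (l' * Q x (b v)) • v + (-(l' * Q x v)) • b v) (x : V) :
    T (T' x) = x + ((l + l') * Q x (b v)) • v + (-((l + l') * Q x v)) • b v := by
  obtain ⟨h1, h2, h3, h4⟩ := table_v hQs haQ hbb hQb hi hv
  simp only [hT, hT', map_add, map_smul, LinearMap.add_apply, LinearMap.smul_apply, smul_eq_mul,
    h1, h2, h3, h4, mul_zero]
  module

/-- Quaternionic transvections are `Q`-isometries. -/
theorem qtransvection_isometry [CharZero K] {l : K} {T : V → V}
    (hT : ∀ x, T x = x + (l * Q x (b v)) • v + (-(l * Q x v)) • b v) (x y : V) :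
    Q (T x) (T y) = Q x y := by
  obtain ⟨h1, h2, h3, h4⟩ := table_v hQs haQ hbb hQb hi hv
  have hvy : Q v y = Q y v := hQs v y
  have hbvy : Q (b v) y = Q y (b v) := hQs (b v) y
  simp only [hT, map_add, map_smul, LinearMap.add_apply, LinearMap.smul_apply, smul_eq_mul,
    h1, h2, h3, h4, hvy, hbvy]
  ring

omit hQs hbb hQb in
/-- A quaternionic transvection along an `i`-eigenvector of `a` commutes with `a`. -/
theorem qtransvection_comm_a (hab : ∀ x, a (b x) = -b (a x)) {l : K} {T : V → V}
    (hT : ∀ x, T x = x + (l * Q x (b v)) • v + (-(l * Q x v)) • b v) (x : V) :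
    T (a x) = a (T x) := by
  have hbv : a (b v) = (-i) • b v := b_eigen hab hv
  have hmi : (-i) * (-i) = -1 := by linear_combination hi
  simp only [hT, map_add, map_smul, hv, hbv, apply_a_eigenvector haQ hi hv,
    apply_a_eigenvector haQ hmi hbv, smul_smul]
  module

omit haQ hi hv in
/-- A quaternionic transvection commutes with `b`. -/
theorem qtransvection_comm_b {l : K} {T : V → V}
    (hT : ∀ x, T x = x + (l * Q x (b v)) • v + (-(l * Q x v)) • b v) (x : V) :
    T (b x) = b (T x) := by
  simp only [hT, map_add, map_smul, hQb, b_left hQs hbb hQb x v, hbb, smul_neg]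
  module

omit hQs haQ hbb hQb hi hv in
/-- The quaternionic transvection with parameter `l` as a linear automorphism (inverse `-l`). -/
theorem exists_qtransvection_equiv [CharZero K] (hQs : ∀ x y, Q x y = Q y x)
    (haQ : ∀ x y, Q (a x) (a y) = Q x y) (hbb : ∀ x, b (b x) = -x)
    (hQb : ∀ x y, Q (b x) (b y) = Q x y) (hi : i * i = -1) (hv : a v = i • v) (l : K) :
    ∃ T : V ≃ₗ[K] V, ∀ x, T x = x + (l * Q x (b v)) • v + (-(l * Q x v)) • b v := by
  have happ : ∀ (l : K) (x : V),
      (LinearMap.id + (l • Q.flip (b v)).smulRight v + ((-l) • Q.flip v).smulRight (b v) :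
        V →ₗ[K] V) x = x + (l * Q x (b v)) • v + (-(l * Q x v)) • b v := by
    intro l x
    simp
  refine ⟨LinearEquiv.ofLinear
      (LinearMap.id + (l • Q.flip (b v)).smulRight v + ((-l) • Q.flip v).smulRight (b v))
      (LinearMap.id + ((-l) • Q.flip (b v)).smulRight v + ((- -l) • Q.flip v).smulRight (b v))
      ?_ ?_, happ l⟩
  · ext x
    rw [LinearMap.comp_apply, LinearMap.id_apply,
      qtransvection_comp hQs haQ hbb hQb hi hv (happ l) (happ (-l))]
    simp
  · ext x
    rw [LinearMap.comp_apply, LinearMap.id_apply,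
      qtransvection_comp hQs haQ hbb hQb hi hv (happ (-l)) (happ l)]
    simp

end transvection

/-! ### §2 The multiplier lemma (no symmetry assumptions on `d`) -/

/-- For `u ≠ 0` there is `y₀` with `Q y₀ u = 1` (right non-degeneracy). -/
theorem exists_dual_vector {W : Type*} [AddCommGroup W] [Module K W] {Q : LinearMap.BilinForm K W}
    (hQr : ∀ u, (∀ x, Q x u = 0) → u = 0) {u : W} (hu : u ≠ 0) : ∃ y₀ : W, Q y₀ u = 1 := by
  obtain ⟨x₁, hx₁⟩ : ∃ x₁, Q x₁ u ≠ 0 := by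
    by_contra! h
    exact hu (hQr u h)
  exact ⟨(Q x₁ u)⁻¹ • x₁, by rw [map_smul, LinearMap.smul_apply, smul_eq_mul, inv_mul_cancel₀ hx₁]⟩

/-- **Multiplier lemma.**  If `Q` is right-non-degenerate on `W` and a bilinear `d` satisfies
`Q y u * d x u + Q x u * d u y = 0` for all `u x y` (the identity produced by invariance under the
transvections `T_{u,1}`, `T_{u,-1}` of an alternating `Q`), then `d x u = μ * Q x u` for ONE scalar `μ`. -/
theorem multiplier_of_identity {W : Type*} [AddCommGroup W] [Module K W]
    (Q : LinearMap.BilinForm K W) (hQr : ∀ u, (∀ x, Q x u = 0) → u = 0)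
    (d : LinearMap.BilinForm K W) (hA : ∀ u x y, Q y u * d x u + Q x u * d u y = 0) :
    ∃ μ : K, ∀ x u, d x u = μ * Q x u := by
  -- (C) `d (·, u)` and `d (u, ·)` are multiples of `Q (·, u)`
  have hC : ∀ u, ∃ μ : K, (∀ x, d x u = μ * Q x u) ∧ ∀ y, d u y = -(μ * Q y u) := by
    intro u
    rcases eq_or_ne u 0 with rfl | hu0
    · exact ⟨0, fun x => by simp, fun y => by simp⟩
    obtain ⟨y₀, hy₀⟩ := exists_dual_vector hQr hu0
    have hx : ∀ x, d x u = -(d u y₀) * Q x u := fun x => by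
      have := hA u x y₀
      rw [hy₀, one_mul] at this
      linear_combination this
    refine ⟨-(d u y₀), hx, fun y => ?_⟩
    have h1 := hA u y₀ y
    rw [hy₀, one_mul] at h1
    have h2 := hx y₀
    rw [hy₀, mul_one] at h2
    linear_combination h1 - (Q y u) * h2
  -- (D) the multiplier is constant
  by_cases hex : ∃ v₀ : W, v₀ ≠ 0
  · obtain ⟨v₀, hv₀⟩ := hex
    obtain ⟨μ, hμ1, hμ2⟩ := hC v₀
    obtain ⟨y₀, hy₀⟩ := exists_dual_vector hQr hv₀
    refine ⟨μ, fun x u => ?_⟩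
    obtain ⟨μu, hu1, hu2⟩ := hC u
    have key : ∀ x y, (μ - μu) * (Q x v₀ * Q y u - Q x u * Q y v₀) = 0 := fun x y => by
      have h := hA (v₀ + u) x y
      simp only [map_add, LinearMap.add_apply, hμ1, hμ2, hu1, hu2] at h
      linear_combination h
    rcases eq_or_ne μ μu with h | hne
    · rw [hu1, h]
    · have prop : ∀ x, Q x u = Q y₀ u * Q x v₀ := fun x => by
        have h1 := key x y₀
        rw [hy₀, mul_one] at h1
        have h2 := (mul_eq_zero.mp h1).resolve_left (sub_ne_zero.mpr hne)
        linear_combination -h2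
      have hut : u = Q y₀ u • v₀ := by
        rw [← sub_eq_zero]
        refine hQr _ fun x => ?_
        rw [map_sub, map_smul, smul_eq_mul, prop x, sub_self]
      calc d x u = d x (Q y₀ u • v₀) := by rw [← hut]
        _ = μ * Q x u := by rw [map_smul, smul_eq_mul, hμ1, prop x]; ring
  · refine ⟨0, fun x u => ?_⟩
    have hu0 : u = 0 := by
      by_contra h
      exact hex ⟨u, h⟩
    simp [hu0]


/-! ### §1b Hyperbolic dilations on a pair `v w ∈ M`, `Q v (b w) = 1`

`D x = x + (α * Q x (b w)) • v + (β * Q x (b v)) • w + (-(α * Q x w)) • b v + (-(β * Q x v)) • b w`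
— on `M` this is the dilation `x ↦ x + α ω(x,w) v + β ω(x,v) w` of the sign file, extended
`b`-equivariantly to `M' = b M`. -/

section dilation

variable [CharZero K] (hQs : ∀ x y, Q x y = Q y x) {a b : V →ₗ[K] V}
  (haQ : ∀ x y, Q (a x) (a y) = Q x y) (hbb : ∀ x, b (b x) = -x)
  (hQb : ∀ x y, Q (b x) (b y) = Q x y) {i : K} (hi : i * i = -1) {v w : V} (hv : a v = i • v)
  (hw : a w = i • w) (hvw : Q v (b w) = 1)
include hQs haQ hbb hQb hi hv hw hvw

/-- The pairing table on `v, w, b v, b w`. -/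
theorem table_vw :
    Q v v = 0 ∧ Q w w = 0 ∧ Q v w = 0 ∧ Q w v = 0 ∧
    Q (b v) (b v) = 0 ∧ Q (b w) (b w) = 0 ∧ Q (b v) (b w) = 0 ∧ Q (b w) (b v) = 0 ∧
    Q v (b v) = 0 ∧ Q w (b w) = 0 ∧ Q (b v) v = 0 ∧ Q (b w) w = 0 ∧
    Q v (b w) = 1 ∧ Q w (b v) = -1 ∧ Q (b w) v = 1 ∧ Q (b v) w = -1 := by
  have hvv := eigen_isotropic haQ hi hv hv
  have hww := eigen_isotropic haQ hi hw hw
  have hvw0 := eigen_isotropic haQ hi hv hw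
  have hwv0 := eigen_isotropic haQ hi hw hv
  have h1 := b_self hQs hbb hQb v
  have h2 := b_self hQs hbb hQb w
  have hwbv : Q w (b v) = -1 := by rw [b_skew hQs hbb hQb w v, hvw]
  refine ⟨hvv, hww, hvw0, hwv0, ?_, ?_, ?_, ?_, h1, h2, ?_, ?_, hvw, hwbv, ?_, ?_⟩
  · rw [hQb, hvv]
  · rw [hQb, hww]
  · rw [hQb, hvw0]
  · rw [hQb, hwv0]
  · rw [hQs, h1]
  · rw [hQs, h2]
  · rw [hQs, hvw]
  · rw [hQs, hwbv]

/-- Two dilations on the same pair compose to the identity when `α' + α + α α' = 0` and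
`β' + β - β β' = 0`. -/
theorem qdilation_comp {α β α' β' : K} (hα : α' + α + α * α' = 0) (hβ : β' + β - β * β' = 0)
    {D D' : V → V}
    (hD : ∀ x, D x = x + (α * Q x (b w)) • v + (β * Q x (b v)) • w + (-(α * Q x w)) • b v +
      (-(β * Q x v)) • b w)
    (hD' : ∀ x, D' x = x + (α' * Q x (b w)) • v + (β' * Q x (b v)) • w + (-(α' * Q x w)) • b v +
      (-(β' * Q x v)) • b w) (x : V) : D (D' x) = x := by
  obtain ⟨t1, t2, t3, t4, t5, t6, t7, t8, t9, t10, t11, t12, t13, t14, t15, t16⟩ :=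
    table_vw hQs haQ hbb hQb hi hv hw hvw
  simp only [hD, hD', map_add, map_smul, LinearMap.add_apply, LinearMap.smul_apply, smul_eq_mul,
    t1, t2, t3, t4, t5, t6, t7, t8, t9, t10, t11, t12, t13, t14, t15, t16]
  have e1 : α' * Q x (b w) + α * (Q x (b w) + α' * Q x (b w) * 1 + β' * Q x (b v) * 0 +
      -(α' * Q x w) * 0 + -(β' * Q x v) * 0) = 0 := by
    linear_combination (Q x (b w)) * hα
  have e2 : β' * Q x (b v) + β * (Q x (b v) + α' * Q x (b w) * 0 + β' * Q x (b v) * (-1) +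
      -(α' * Q x w) * 0 + -(β' * Q x v) * 0) = 0 := by
    linear_combination (Q x (b v)) * hβ
  have e3 : -(α' * Q x w) + -(α * (Q x w + α' * Q x (b w) * 0 + β' * Q x (b v) * 0 +
      -(α' * Q x w) * (-1) + -(β' * Q x v) * 0)) = 0 := by
    linear_combination -(Q x w) * hα
  have e4 : -(β' * Q x v) + -(β * (Q x v + α' * Q x (b w) * 0 + β' * Q x (b v) * 0 +
      -(α' * Q x w) * 0 + -(β' * Q x v) * 1)) = 0 := by
    linear_combination -(Q x v) * hβ
  linear_combination (norm := module) e1 • v + e2 • w + e3 • b v + e4 • b w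

/-- A dilation is a `Q`-isometry when `α - β - α β = 0`. -/
theorem qdilation_isometry {α β : K} (hαβ : α - β - α * β = 0) {D : V → V}
    (hD : ∀ x, D x = x + (α * Q x (b w)) • v + (β * Q x (b v)) • w + (-(α * Q x w)) • b v +
      (-(β * Q x v)) • b w) (x y : V) : Q (D x) (D y) = Q x y := by
  obtain ⟨t1, t2, t3, t4, t5, t6, t7, t8, t9, t10, t11, t12, t13, t14, t15, t16⟩ :=
    table_vw hQs haQ hbb hQb hi hv hw hvw
  have s1 : Q v y = Q y v := hQs v y
  have s2 : Q w y = Q y w := hQs w y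
  have s3 : Q (b v) y = Q y (b v) := hQs (b v) y
  have s4 : Q (b w) y = Q y (b w) := hQs (b w) y
  simp only [hD, map_add, map_smul, LinearMap.add_apply, LinearMap.smul_apply, smul_eq_mul,
    t1, t2, t3, t4, t5, t6, t7, t8, t9, t10, t11, t12, t13, t14, t15, t16, s1, s2, s3, s4]
  linear_combination (Q x v * Q y (b w) + Q x (b w) * Q y v - Q x (b v) * Q y w -
    Q x w * Q y (b v)) * hαβ

omit [CharZero K] hQs hbb hQb hvw in
/-- A dilation on a pair inside `M` commutes with `a`. -/
theorem qdilation_comm_a (hab : ∀ x, a (b x) = -b (a x)) {α β : K} {D : V → V}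
    (hD : ∀ x, D x = x + (α * Q x (b w)) • v + (β * Q x (b v)) • w + (-(α * Q x w)) • b v +
      (-(β * Q x v)) • b w) (x : V) : D (a x) = a (D x) := by
  have hbv : a (b v) = (-i) • b v := b_eigen hab hv
  have hbw : a (b w) = (-i) • b w := b_eigen hab hw
  have hmi : (-i) * (-i) = -1 := by linear_combination hi
  simp only [hD, map_add, map_smul, hv, hw, hbv, hbw, apply_a_eigenvector haQ hi hv,
    apply_a_eigenvector haQ hi hw, apply_a_eigenvector haQ hmi hbv,
    apply_a_eigenvector haQ hmi hbw, smul_smul]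
  module

omit [CharZero K] haQ hi hv hw hvw in
/-- A dilation commutes with `b`. -/
theorem qdilation_comm_b {α β : K} {D : V → V}
    (hD : ∀ x, D x = x + (α * Q x (b w)) • v + (β * Q x (b v)) • w + (-(α * Q x w)) • b v +
      (-(β * Q x v)) • b w) (x : V) : D (b x) = b (D x) := by
  simp only [hD, map_add, map_smul, hQb, b_left hQs hbb hQb x v, b_left hQs hbb hQb x w, hbb,
    smul_neg]
  module

/-- Conjugation relation `D ∘ T_l = T_{l''} ∘ D` with `l'' (1 - β) = l (1 + α)`. -/
theorem qdilation_qtransvection {α β l l'' : K} (h : l'' * (1 - β) = l * (1 + α)) {D T : V → V}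
    (hD : ∀ x, D x = x + (α * Q x (b w)) • v + (β * Q x (b v)) • w + (-(α * Q x w)) • b v +
      (-(β * Q x v)) • b w)
    (hT : ∀ x, T x = x + (l * Q x (b v)) • v + (-(l * Q x v)) • b v) (y : V) :
    D (T y) = D y + (l'' * Q (D y) (b v)) • v + (-(l'' * Q (D y) v)) • b v := by
  obtain ⟨t1, t2, t3, t4, t5, t6, t7, t8, t9, t10, t11, t12, t13, t14, t15, t16⟩ :=
    table_vw hQs haQ hbb hQb hi hv hw hvw
  simp only [hD, hT, map_add, map_smul, LinearMap.add_apply, LinearMap.smul_apply, smul_eq_mul,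
    t1, t3, t4, t5, t7, t8, t9, t11, t13, t14, t15, t16]
  linear_combination (norm := module) (-(Q y (b v)) * h) • v + ((Q y v) * h) • b v

omit hQs haQ hbb hQb hi hv hw hvw in
/-- The dilation with `λ = 2` (`α = 1`, `β = 1/2`; inverse `α' = -1/2`, `β' = -1`) as a linear
automorphism. -/
theorem exists_qdilation_equiv (hQs : ∀ x y, Q x y = Q y x) (haQ : ∀ x y, Q (a x) (a y) = Q x y)
    (hbb : ∀ x, b (b x) = -x) (hQb : ∀ x y, Q (b x) (b y) = Q x y) (hi : i * i = -1)
    (hv : a v = i • v) (hw : a w = i • w) (hvw : Q v (b w) = 1) :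
    ∃ D : V ≃ₗ[K] V, ∀ x, D x = x + (1 * Q x (b w)) • v + (1 / 2 * Q x (b v)) • w +
      (-(1 * Q x w)) • b v + (-(1 / 2 * Q x v)) • b w := by
  have happ : ∀ (α β : K) (x : V),
      (LinearMap.id + (α • Q.flip (b w)).smulRight v + (β • Q.flip (b v)).smulRight w +
        ((-α) • Q.flip w).smulRight (b v) + ((-β) • Q.flip v).smulRight (b w) : V →ₗ[K] V) x =
        x + (α * Q x (b w)) • v + (β * Q x (b v)) • w + (-(α * Q x w)) • b v +
          (-(β * Q x v)) • b w := by
    intro α β x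
    simp
  refine ⟨LinearEquiv.ofLinear
      (LinearMap.id + ((1 : K) • Q.flip (b w)).smulRight v + ((1 / 2 : K) • Q.flip (b v)).smulRight w
        + ((-(1 : K)) • Q.flip w).smulRight (b v) + ((-(1 / 2 : K)) • Q.flip v).smulRight (b w))
      (LinearMap.id + ((-(1 / 2) : K) • Q.flip (b w)).smulRight v + ((-1 : K) • Q.flip (b v)).smulRight w
        + ((-(-(1 / 2) : K)) • Q.flip w).smulRight (b v) + ((-(-1 : K)) • Q.flip v).smulRight (b w))
      ?_ ?_, happ 1 (1 / 2)⟩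
  · ext x
    rw [LinearMap.comp_apply, LinearMap.id_apply]
    exact qdilation_comp hQs haQ hbb hQb hi hv hw hvw (by norm_num) (by norm_num) (happ 1 (1 / 2))
      (happ (-(1 / 2)) (-1)) x
  · ext x
    rw [LinearMap.comp_apply, LinearMap.id_apply]
    exact qdilation_comp hQs haQ hbb hQb hi hv hw hvw (by norm_num) (by norm_num)
      (happ (-(1 / 2)) (-1)) (happ 1 (1 / 2)) x

end dilation

end Summit.HodgeConjecture.HodgeConjecture.Theorems.Q8CommutatorDegreeTwoCoreTransvections
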